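import Summits.AtomisticToContinuum.Crystallization.Theorems.ChartedZeroExcessLayeredLatticeLiouvilleZZZYB

/-!
# ChartedZeroExcess · LayeredLatticeLiouville ZZZYC (lens-2 g91 NODE 91 part 1 «FrameKit») — the finite-dimensional kit of the discrete
# F. John synthesis for the kinematic leaf (SC♮′) `CoherentZoneShadowCrystalP … (27/32) …` (PLAN-g91-SC §3 (F1)–(F4), (COV); critic rows 1613/1615/1618)
Everything here is GENERIC: a set `S` of `(1/16, 9/10, 1)`-two-shell-good points, a sub-family `M ⊆ S` of sites carrying FRAMES `v ↦ Ψ x + Q x (v − x)`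
(`Q x` a linear isometry, `Ψ` the label map) that FIT the `4`-stars: `dist (Q x (p − x)) (Ψ p − Ψ x) ≤ ϑ` (`p ∈ S`, `dist p x ≤ 4`) — verbatim the third
clause of `IsCoherentTameOn ϑ S H M`.  No configuration geometry, no moat, no `K`.
* §1 (F1) SYMBOLIC: two linear isometries `η`-close on a `μ`-lower-fat triple (`μ > 0`) are `(η/μ)‖z‖`-close everywhere (`dist_map_le_of_fat`); the one
  numerical input is the side lemma `three_div_fat_le_ten`: `3/((27/80)·a) ≤ 10` for `a ≥ 9/10` (MARGIN: `2400/243 = 9.877 < 10`).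
* §2 (F2) THE TRIPOD of a good point `x`: three sites `p m ∈ S`, `dist (p m) x ≤ 17/16`, `(p m − x)` `(27/80)·a`-lower-fat, `a ∈ [9/10, 1]`
  (`exists_fatTripod`; fatness `2/5·a` of the canonical triple minus the matching tolerance `a/16`, tree ZZZXC).
* §3 (F3) PAIR STEP: frames at sites `x, y ∈ M`, `dist x y ≤ 2`, read the three tripod sites of `x` and the site `x` itself (four fits, all inside the
  `4`-stars: `17/16 + 2 ≤ 4`) ⟹ `dist (Q x z) (Q y z) ≤ 10ϑ‖z‖` and `dist (frame_x v) (frame_y v) ≤ ϑ(1 + 10·dist v x)` (`frame_pair`); its BALL form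
  `agree_hop` (agreement with any rigid reading `v ↦ U (v − t)` on `closedBall x₀ R` degrades by `ϑ(1 + 20R)` per bonded step) is what the routing iterates.
* §4 (F4) REGISTRATION: with `U := Q x⋆`, `t := x⋆ − U⁻¹ (Ψ x⋆)` the rigid reading IS the frame of `x⋆` (`frame_read`), and a label `Ψ p ∈ H₀` read within `ε`
  registers `p` within `ε` of `placedCrystal L′ w′ U t` (`registered_of_frame`); conversely a placed site reads as its label (`read_placed`).
* §5 (COV) COVERING RADIUS `< 4/5` of a separated good set (`exists_mem_dist_lt_four_fifths`, minimiser + `clean_hop_sq`; standalone, r1613) and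
  HOP-TO-ATOM uniqueness below the hard core `27/32` (`eq_of_dist_lt_four_fifths`; MARGIN `27/32 − 4/5 = 7/160`, and `4/5 + 10⁻⁴ < 27/32` for REG-in).
0 sorry · import = tree ZZZYB only · 0 defs · no instances/notation/options · axioms standard. [g91]
-/

noncomputable section

open scoped BigOperators RealInnerProductSpace
open MeasureTheory Set Metric Filter Topology
open Summit.AtomisticToContinuum.Crystallization.Theorems.ChartedPlanarOrderRigidityDoor (E3)
open Summit.AtomisticToContinuum.Crystallization.Theorems.ChartedPlanarOrderDensityDichotomy (IsSep)
open Summit.AtomisticToContinuum.Crystallization.Theorems.ChartedPlanarOrderCleanStackedIndependent (finite_sep_inter_closedBall)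
open Summit.AtomisticToContinuum.Crystallization.Theorems.ChartedPlanarOrderMesoCut (LayeredHom)
open Literature.Geometry.DiscreteGeometry (IsTwoShellGoodSet fccTwoShellPattern hcpTwoShellPattern)

namespace Summit.AtomisticToContinuum.Crystallization.Theorems.ChartedZeroExcessLayeredLatticeLiouville

/-! ### ZZZYC-1  (F1) isometries close on a fat triple are close everywhere — SYMBOLIC, plus the one numerical side lemma -/

section FatClose

/-- ★ (F1) SYMBOLIC (PROVED): two linear isometries within `η` on a `μ`-lower-fat triple (`μ > 0`) are within `(η/μ)·‖z‖` at every `z`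
(write `z = Σ α m • t m` with `Σ|α m| ≤ ‖z‖/μ`, `exists_coeff_of_isLowerFat`). [g91] -/
theorem dist_map_le_of_fat {μ η : ℝ} {t : Fin 3 → E3} (hμ : 0 < μ) (ht : IsLowerFat μ t) (U V : E3 ≃ₗᵢ[ℝ] E3)
    (hUV : ∀ m, dist (U (t m)) (V (t m)) ≤ η) (z : E3) : dist (U z) (V z) ≤ η / μ * ‖z‖ := by
  obtain ⟨α, hz, hα⟩ := exists_coeff_of_isLowerFat hμ ht z
  have hη : 0 ≤ η := dist_nonneg.trans (hUV 0)
  have e : U z - V z = ∑ m, α m • (U (t m) - V (t m)) := by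
    rw [hz, map_sum, map_sum, ← Finset.sum_sub_distrib]
    refine Finset.sum_congr rfl fun m _ => ?_
    rw [map_smul, map_smul, smul_sub]
  rw [dist_eq_norm, e]
  calc ‖∑ m, α m • (U (t m) - V (t m))‖ ≤ ∑ m, ‖α m • (U (t m) - V (t m))‖ := norm_sum_le _ _
    _ ≤ ∑ m, |α m| * η := Finset.sum_le_sum fun m _ => by
        rw [norm_smul, Real.norm_eq_abs, ← dist_eq_norm]
        exact mul_le_mul_of_nonneg_left (hUV m) (abs_nonneg _)
    _ = (∑ m, |α m|) * η := by rw [Finset.sum_mul]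
    _ ≤ ‖z‖ / μ * η := mul_le_mul_of_nonneg_right hα hη
    _ = η / μ * ‖z‖ := by ring

/-- THE NUMERICAL SIDE LEMMA of (F1) at the record (PROVED, `norm_num`): three fits (`η = 3ϑ`) over the tripod fatness `(27/80)·a`, `a ≥ 9/10`, cost at most
`10ϑ`: `3ϑ/((27/80)·a) ≤ 10ϑ` (exact worst case `2400/243 = 9.8765…`; MARGIN `0.12`). [g91] -/
theorem three_div_fat_le_ten {a ϑ : ℝ} (ha : 9 / 10 ≤ a) (hϑ : 0 ≤ ϑ) : 3 * ϑ / (27 / 80 * a) ≤ 10 * ϑ := by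
  have ha0 : 0 < 27 / 80 * a := by linarith
  rw [div_le_iff₀ ha0]
  nlinarith

end FatClose

/-! ### ZZZYC-2  (F2) the tripod of a good point -/

section Tripod

/-- ★ (F2) THE TRIPOD (PROVED): a `(1/16, 9/10, 1)`-two-shell-good point `x` of `Y` has three sites `p m ∈ Y` (the images of the canonical triple,
which lies in both two-shell patterns) with `dist (p m) x ≤ 17/16` and `(p m − x)` `(27/80)·a`-LOWER-FAT at the local scale `a ∈ [9/10, 1]`
(`(2/5)·a` transported fatness minus the matching tolerance `a/16`, `isLowerFat_of_near_canonTriple`). [g91] -/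
theorem exists_fatTripod {Y : Set E3} {x : E3} (hx : IsTwoShellGoodSet (1 / 16) (9 / 10) 1 Y x) :
    ∃ a : ℝ, 9 / 10 ≤ a ∧ a ≤ 1 ∧ ∃ p : Fin 3 → E3,
      (∀ m, p m ∈ Y) ∧ (∀ m, dist (p m) x ≤ 17 / 16) ∧ IsLowerFat (27 / 80 * a) (fun m => p m - x) := by
  obtain ⟨a, ha1, ha2, A, P, f, hP, hf, -, -⟩ := hx
  have ha0 : 0 ≤ a := by linarith
  have hfit : ∀ m, dist (f (canonTriple m) - x) (a • A (canonTriple m)) ≤ 1 / 16 * a := fun m => by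
    have e : dist (f (canonTriple m) - x) (a • A (canonTriple m)) = dist (f (canonTriple m)) (x + a • A (canonTriple m)) := by
      rw [dist_eq_norm, dist_eq_norm]; congr 1; abel
    rw [e]; exact (hf _ (canonTriple_mem_of_pattern hP m)).2
  refine ⟨a, ha1, ha2, fun m => f (canonTriple m), fun m => (hf _ (canonTriple_mem_of_pattern hP m)).1, fun m => ?_, ?_⟩
  · have hn : ‖a • A (canonTriple m)‖ = a := by
      rw [norm_smul, A.norm_map, norm_canonTriple, mul_one, Real.norm_of_nonneg ha0]
    have h1 : dist (f (canonTriple m) - x) 0 ≤ dist (f (canonTriple m) - x) (a • A (canonTriple m)) + dist (a • A (canonTriple m)) 0 :=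
      dist_triangle _ _ _
    rw [dist_zero_right, dist_zero_right, hn, ← dist_eq_norm] at h1
    linarith [hfit m]
  · have h := isLowerFat_of_near_canonTriple (w := fun m => f (canonTriple m) - x) A ha0 (τ := 1 / 16 * a) fun m => by
      rw [← dist_eq_norm]; exact hfit m
    have e : (2 / 5 * a - 1 / 16 * a : ℝ) = 27 / 80 * a := by ring
    rw [e] at h
    exact h

end Tripod

/-! ### ZZZYC-3  (F3) the pair step: bonded frames agree to first order -/

section Pair

variable {S M : Set E3} {Ψ : E3 → E3} {Q : E3 → (E3 ≃ₗᵢ[ℝ] E3)} {ϑ : ℝ}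

/-- ★★ (F3) THE PAIR STEP (PROVED): if the frames at `x, y ∈ M` fit the `4`-stars (`hfit`), `x ∈ S` is a good point and `dist x y ≤ 2`, then the four
fits (the tripod `p m` of `x` read from `x` and from `y` — `dist (p m) y ≤ 17/16 + 2 ≤ 4` — and `x` read from `y`) give `dist (Q x (p m − x)) (Q y (p m − x))
≤ 3ϑ`, hence by (F1) `dist (Q x z) (Q y z) ≤ 10ϑ‖z‖`, and the affine frames differ by `≤ ϑ(1 + 10·dist v x)` at `v`. [g91] -/
theorem frame_pair (hfit : ∀ x ∈ M, ∀ p ∈ S, dist p x ≤ 4 → dist ((Q x) (p - x)) (Ψ p - Ψ x) ≤ ϑ) {x y : E3} (hxS : x ∈ S)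
    (hxg : IsTwoShellGoodSet (1 / 16) (9 / 10) 1 S x) (hx : x ∈ M) (hy : y ∈ M) (hxy : dist x y ≤ 2) :
    (∀ z : E3, dist (Q x z) (Q y z) ≤ 10 * ϑ * ‖z‖) ∧
      ∀ v : E3, dist (Ψ x + Q x (v - x)) (Ψ y + Q y (v - y)) ≤ ϑ * (1 + 10 * dist v x) := by
  obtain ⟨a, ha1, -, p, hpS, hpx, hfat⟩ := exists_fatTripod hxg
  have hϑ : 0 ≤ ϑ := dist_nonneg.trans (hfit y hy x hxS (by linarith [hxy]))
  have hxy' : dist ((Q y) (x - y)) (Ψ x - Ψ y) ≤ ϑ := hfit y hy x hxS (by linarith [hxy])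
  have h3 : ∀ m, dist (Q x (p m - x)) (Q y (p m - x)) ≤ 3 * ϑ := fun m => by
    have h1 : dist ((Q x) (p m - x)) (Ψ (p m) - Ψ x) ≤ ϑ := hfit x hx (p m) (hpS m) (by linarith [hpx m])
    have h2 : dist ((Q y) (p m - y)) (Ψ (p m) - Ψ y) ≤ ϑ :=
      hfit y hy (p m) (hpS m) (by linarith [hpx m, dist_triangle (p m) x y])
    have e1 : (Q y) (p m - x) = (Q y) (p m - y) - (Q y) (x - y) := by rw [← map_sub]; congr 1; abel
    have e2 : Ψ (p m) - Ψ x = (Ψ (p m) - Ψ y) - (Ψ x - Ψ y) := by abel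
    have h4 : dist ((Q y) (p m - x)) (Ψ (p m) - Ψ x) ≤ ϑ + ϑ := by
      rw [e1, e2]; exact (dist_sub_sub_le _ _ _ _).trans (add_le_add h2 hxy')
    linarith [dist_triangle ((Q x) (p m - x)) (Ψ (p m) - Ψ x) ((Q y) (p m - x)), dist_comm ((Q y) (p m - x)) (Ψ (p m) - Ψ x)]
  have hμ : (0 : ℝ) < 27 / 80 * a := by linarith
  have hrot : ∀ z : E3, dist (Q x z) (Q y z) ≤ 10 * ϑ * ‖z‖ := fun z =>
    (dist_map_le_of_fat hμ hfat (Q x) (Q y) h3 z).trans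
      (mul_le_mul_of_nonneg_right (three_div_fat_le_ten ha1 hϑ) (norm_nonneg z))
  refine ⟨hrot, fun v => ?_⟩
  have e1 : (Q y) (v - y) = (Q y) (v - x) + (Q y) (x - y) := by rw [← map_add]; congr 1; abel
  have e2 : Ψ x + (Q x) (v - x) - (Ψ y + (Q y) (v - y)) = ((Q x) (v - x) - (Q y) (v - x)) - ((Q y) (x - y) - (Ψ x - Ψ y)) := by
    rw [e1]; abel
  rw [dist_eq_norm, e2]
  calc ‖(Q x) (v - x) - (Q y) (v - x) - ((Q y) (x - y) - (Ψ x - Ψ y))‖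
      ≤ ‖(Q x) (v - x) - (Q y) (v - x)‖ + ‖(Q y) (x - y) - (Ψ x - Ψ y)‖ := norm_sub_le _ _
    _ ≤ 10 * ϑ * ‖v - x‖ + ϑ := by rw [← dist_eq_norm, ← dist_eq_norm]; exact add_le_add (hrot _) hxy'
    _ = ϑ * (1 + 10 * dist v x) := by rw [dist_eq_norm]; ring

/-- ★★ (F3-ball) THE AGREEMENT STEP (PROVED) — the form the routing iterates: if the frame of `x` agrees with a rigid reading `v ↦ U (v − t)` to within `G`
on `closedBall x₀ R`, `dist x x₀ ≤ R`, and `y ∈ M` is within `2` of the good site `x ∈ M ∩ S`, then the frame of `y` agrees with the same reading to within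
`G + ϑ(1 + 20R)` on that ball (`dist v x ≤ 2R`). [g91] -/
theorem agree_hop (hfit : ∀ x ∈ M, ∀ p ∈ S, dist p x ≤ 4 → dist ((Q x) (p - x)) (Ψ p - Ψ x) ≤ ϑ) {x y : E3} (hxS : x ∈ S)
    (hxg : IsTwoShellGoodSet (1 / 16) (9 / 10) 1 S x) (hx : x ∈ M) (hy : y ∈ M) (hxy : dist x y ≤ 2) {U : E3 ≃ₗᵢ[ℝ] E3} {t x₀ : E3}
    {R G : ℝ} (hxR : dist x x₀ ≤ R) (hG : ∀ v : E3, dist v x₀ ≤ R → dist (U (v - t)) (Ψ x + Q x (v - x)) ≤ G) :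
    ∀ v : E3, dist v x₀ ≤ R → dist (U (v - t)) (Ψ y + Q y (v - y)) ≤ G + ϑ * (1 + 20 * R) := by
  intro v hv
  have hϑ : 0 ≤ ϑ := dist_nonneg.trans (hfit y hy x hxS (by linarith [hxy]))
  have hvx : dist v x ≤ 2 * R := by linarith [dist_triangle v x₀ x, dist_comm x x₀]
  have h := (frame_pair hfit hxS hxg hx hy hxy).2 v
  have hmono : ϑ * (1 + 10 * dist v x) ≤ ϑ * (1 + 20 * R) := mul_le_mul_of_nonneg_left (by linarith) hϑ
  linarith [dist_triangle (U (v - t)) (Ψ x + Q x (v - x)) (Ψ y + Q y (v - y)), hG v hv]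

end Pair

/-! ### ZZZYC-4  (LEG, WALK) propagation along hops toward a way-point, and along a chain of way-points -/

section Leg

variable {S M : Set E3} {Ψ : E3 → E3} {Q : E3 → (E3 ≃ₗᵢ[ℝ] E3)} {ϑ : ℝ}

/-- ★★ (LEG) ONE LEG (PROVED): hop (`clean_hop_sq`) from a site `q ∈ S` with `dist q w ≤ 1` toward a WAY-POINT `w` whose unit neighbourhood is SAFE
(`S ∩ closedBall w 1 ⊆ M`) and inside the agreement ball (`dist w x₀ ≤ R − 1`): the squared distance to `w` drops by `≥ 1/100` per hop, every hop site
stays within `1` of `w` (hence in `M`), and after `≤ n` hops (`100·dist² < n + 1`) a site `q′ ∈ S` with `dist q′ w < 4/5` is reached whose frame agrees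
with the rigid reading to within `G + n·ϑ(1 + 20R)` (one `agree_hop` per hop).  No chain object is built: the induction carries the agreement. [g91] -/
theorem frame_leg (hϑ : 0 ≤ ϑ) (hfit : ∀ x ∈ M, ∀ p ∈ S, dist p x ≤ 4 → dist ((Q x) (p - x)) (Ψ p - Ψ x) ≤ ϑ)
    (hgood : ∀ q ∈ S, IsTwoShellGoodSet (1 / 16) (9 / 10) 1 S q) {U : E3 ≃ₗᵢ[ℝ] E3} {t x₀ w : E3} {R : ℝ} (hw : dist w x₀ ≤ R - 1)
    (hsafe : ∀ y ∈ S, dist y w ≤ 1 → y ∈ M) :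
    ∀ n : ℕ, ∀ G : ℝ, ∀ q ∈ S, dist q w ≤ 1 → 100 * dist q w ^ 2 < n + 1 →
      (∀ v : E3, dist v x₀ ≤ R → dist (U (v - t)) (Ψ q + Q q (v - q)) ≤ G) →
        ∃ q' ∈ S, dist q' w < 4 / 5 ∧
          ∀ v : E3, dist v x₀ ≤ R → dist (U (v - t)) (Ψ q' + Q q' (v - q')) ≤ G + n * (ϑ * (1 + 20 * R)) := by
  have hR : 0 ≤ 1 + 20 * R := by linarith [dist_nonneg (x := w) (y := x₀)]
  have hc : 0 ≤ ϑ * (1 + 20 * R) := mul_nonneg hϑ hR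
  intro n
  induction n with
  | zero =>
    intro G q hq hqw hlt hG
    refine ⟨q, hq, ?_, fun v hv => by simpa using hG v hv⟩
    by_contra hfar
    rw [not_lt] at hfar
    push_cast at hlt
    nlinarith [mul_le_mul hfar hfar (by norm_num) dist_nonneg]
  | succ n ih =>
    intro G q hq hqw hlt hG
    by_cases hnear : dist q w < 4 / 5
    · refine ⟨q, hq, hnear, fun v hv => (hG v hv).trans ?_⟩
      have h0 : (0 : ℝ) ≤ ((n + 1 : ℕ) : ℝ) * (ϑ * (1 + 20 * R)) := by positivity
      linarith
    · rw [not_lt] at hnear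
      obtain ⟨q₁, hq₁, -, hqq₁, hsq⟩ := clean_hop_sq (hgood q hq) hnear
      have hq₁w : dist q₁ w ≤ dist q w := le_of_pow_le_pow_left₀ two_ne_zero dist_nonneg (by linarith)
      have hlt₁ : 100 * dist q₁ w ^ 2 < n + 1 := by push_cast at hlt; linarith
      have hqR : dist q x₀ ≤ R := by linarith [dist_triangle q w x₀]
      have hG₁ := agree_hop hfit hq (hgood q hq) (hsafe q hq hqw) (hsafe q₁ hq₁ (hq₁w.trans hqw)) (hqq₁.trans (by norm_num)) hqR hG
      obtain ⟨q', hq', hq'w, hG'⟩ := ih (G + ϑ * (1 + 20 * R)) q₁ hq₁ (hq₁w.trans hqw) hlt₁ hG₁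
      refine ⟨q', hq', hq'w, fun v hv => (hG' v hv).trans_eq ?_⟩
      push_cast; ring

/-- ★★ (WALK) A CHAIN OF LEGS (PROVED): way-points `wp 0, …, wp J`, consecutive ones `≤ 1/5` apart, each with a safe unit neighbourhood inside the agreement
ball; from a site `q ∈ S` with `dist q (wp 0) ≤ 1` one reaches, for every `j ≤ J`, a site `q′ ∈ S` with `dist q′ (wp j) < 4/5` and agreement within
`G + (j + 1)·100·ϑ(1 + 20R)` (each leg starts within `4/5 + 1/5 = 1` of its way-point and costs `≤ 100` hops). [g91] -/
theorem frame_walk (hϑ : 0 ≤ ϑ) (hfit : ∀ x ∈ M, ∀ p ∈ S, dist p x ≤ 4 → dist ((Q x) (p - x)) (Ψ p - Ψ x) ≤ ϑ)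
    (hgood : ∀ q ∈ S, IsTwoShellGoodSet (1 / 16) (9 / 10) 1 S q) {U : E3 ≃ₗᵢ[ℝ] E3} {t x₀ : E3} {R : ℝ} {wp : ℕ → E3} {J : ℕ}
    (hwR : ∀ j, j ≤ J → dist (wp j) x₀ ≤ R - 1) (hsafe : ∀ j, j ≤ J → ∀ y ∈ S, dist y (wp j) ≤ 1 → y ∈ M)
    (hstep : ∀ j, j < J → dist (wp (j + 1)) (wp j) ≤ 1 / 5) {G : ℝ} {q : E3} (hq : q ∈ S) (hqw : dist q (wp 0) ≤ 1)
    (hG : ∀ v : E3, dist v x₀ ≤ R → dist (U (v - t)) (Ψ q + Q q (v - q)) ≤ G) :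
    ∀ j, j ≤ J → ∃ q' ∈ S, dist q' (wp j) < 4 / 5 ∧
      ∀ v : E3, dist v x₀ ≤ R → dist (U (v - t)) (Ψ q' + Q q' (v - q')) ≤ G + (j + 1) * (100 * (ϑ * (1 + 20 * R))) := by
  have hsq : ∀ {q' : E3} {w : E3}, dist q' w ≤ 1 → 100 * dist q' w ^ 2 < (100 : ℕ) + 1 := fun h => by
    have := pow_le_one₀ (n := 2) dist_nonneg h
    push_cast; linarith
  intro j
  induction j with
  | zero =>
    intro _
    obtain ⟨q', hq', hd, hG'⟩ := frame_leg hϑ hfit hgood (hwR 0 (Nat.zero_le J)) (hsafe 0 (Nat.zero_le J)) 100 G q hq hqw (hsq hqw) hG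
    exact ⟨q', hq', hd, fun v hv => (hG' v hv).trans_eq (by push_cast; ring)⟩
  | succ j ih =>
    intro hj
    obtain ⟨q₁, hq₁, hd₁, hG₁⟩ := ih (Nat.le_of_succ_le hj)
    have h1 : dist q₁ (wp (j + 1)) ≤ 1 := by
      linarith [dist_triangle q₁ (wp j) (wp (j + 1)), hstep j hj, dist_comm (wp (j + 1)) (wp j)]
    obtain ⟨q', hq', hd, hG'⟩ := frame_leg hϑ hfit hgood (hwR (j + 1) hj) (hsafe (j + 1) hj) 100 _ q₁ hq₁ h1 (hsq h1) hG₁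
    exact ⟨q', hq', hd, fun v hv => (hG' v hv).trans_eq (by push_cast; ring)⟩

end Leg

/-! ### ZZZYC-5  (F4) registration by the frame of one site -/

section Registration

/-- (F4) THE RIGID READING OF THE MASTER FRAME (PROVED): with `t := x⋆ − U⁻¹ Ψ⋆`, `U (v − t) = Ψ⋆ + U (v − x⋆)` — so for `U := Q x⋆`, `Ψ⋆ := Ψ x⋆`
the rigid reading is the frame of `x⋆` on the nose (agreement constant `0` at the root). [g91] -/
theorem frame_read (U : E3 ≃ₗᵢ[ℝ] E3) (xs Ψs v : E3) : U (v - (xs - U.symm Ψs)) = Ψs + U (v - xs) := by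
  have e : v - (xs - U.symm Ψs) = U.symm Ψs + (v - xs) := by abel
  rw [e, map_add, LinearIsometryEquiv.apply_symm_apply]

/-- (F4) THE FRAME PREDICTS THE LABEL (PROVED): `dist (Ψ x + Q x (p − x)) (Ψ p) = dist (Q x (p − x)) (Ψ p − Ψ x)` — so a fit `≤ ϑ` at `x` reading `p`
says the frame of `x` locates the label `Ψ p` to within `ϑ`. [g91] -/
theorem frame_label (V : E3 ≃ₗᵢ[ℝ] E3) (Ψx Ψp z : E3) : dist (Ψx + V z) Ψp = dist (V z) (Ψp - Ψx) := by
  rw [dist_eq_norm, dist_eq_norm]; congr 1; abel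

/-- ★ (F4) REGISTRATION (PROVED): if the reading of `p` lies within `ε` of a site `h` of `H₀ = LayeredHom L′ w′` — `dist (U (p − t)) h ≤ ε` — then `p` is
within `ε` of the placed crystal `placedCrystal L′ w′ U t` (at `c := U⁻¹ h + t`). [g91] -/
theorem registered_of_read {L' : E3 →L[ℝ] E3} {w' : ℤ → E3} (U : E3 ≃ₗᵢ[ℝ] E3) (t : E3) {p h : E3} {ε : ℝ} (hh : h ∈ LayeredHom L' w')
    (hd : dist (U (p - t)) h ≤ ε) : ∃ c ∈ placedCrystal L' w' U t, dist p c ≤ ε := by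
  refine ⟨U.symm h + t, ?_, ?_⟩
  · show U (U.symm h + t - t) ∈ LayeredHom L' w'
    simpa using hh
  · have e : dist p (U.symm h + t) = dist (U (p - t)) h := by
      rw [← U.dist_map p (U.symm h + t), ← dist_sub_right (U p) (U (U.symm h + t)) (U t), ← map_sub, ← map_sub]
      simp
    rw [e]; exact hd

/-- ★ (F4) REGISTRATION BY THE MASTER FRAME (PROVED): `U := Q x⋆`-type reading, `t := x⋆ − U⁻¹ Ψ⋆`; a label `Ψp ∈ H₀` with
`dist (Ψ⋆ + U (p − x⋆)) Ψp ≤ ε` registers `p` within `ε` of `placedCrystal L′ w′ U (x⋆ − U⁻¹ Ψ⋆)`. [g91] -/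
theorem registered_of_frame {L' : E3 →L[ℝ] E3} {w' : ℤ → E3} (U : E3 ≃ₗᵢ[ℝ] E3) (xs Ψs : E3) {p Ψp : E3} {ε : ℝ}
    (hmem : Ψp ∈ LayeredHom L' w') (hd : dist (Ψs + U (p - xs)) Ψp ≤ ε) :
    ∃ c ∈ placedCrystal L' w' U (xs - U.symm Ψs), dist p c ≤ ε :=
  registered_of_read U _ hmem (by rw [frame_read]; exact hd)

/-- (F4, converse reading) a site `c` of the placed crystal reads as the crystal site `U (c − t) ∈ H₀`, and for every `p`,
`dist p c = dist (U (p − t)) (U (c − t))` (REG-in compares an atom with a placed site in crystal coordinates). [g91] -/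
theorem read_placed {L' : E3 →L[ℝ] E3} {w' : ℤ → E3} (U : E3 ≃ₗᵢ[ℝ] E3) (t : E3) {c : E3} (hc : c ∈ placedCrystal L' w' U t) (p : E3) :
    U (c - t) ∈ LayeredHom L' w' ∧ dist p c = dist (U (p - t)) (U (c - t)) :=
  ⟨hc, by rw [U.dist_map, dist_sub_right]⟩

end Registration

/-! ### ZZZYC-6  (COV) covering radius `< 4/5` and hop-to-atom uniqueness -/

section Cover

variable {δ : ℝ} {S : Set E3}

/-- ★★ (COV) COVERING RADIUS `< 4/5` (PROVED, standalone): a `δ`-separated (`δ > 0`), nonempty set all of whose points are `(1/16, 9/10, 1)`-good meets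
every open ball of radius `4/5` — the site of `S ∩ closedBall x (dist y₁ x)` (finite) nearest to `x` cannot be at distance `≥ 4/5`, else `clean_hop_sq`
finds a strictly nearer site of the same ball. [g91] -/
theorem exists_mem_dist_lt_four_fifths (hδ : 0 < δ) (hS : IsSep δ S) (hgood : ∀ q ∈ S, IsTwoShellGoodSet (1 / 16) (9 / 10) 1 S q)
    (hne : S.Nonempty) (x : E3) : ∃ y ∈ S, dist y x < 4 / 5 := by
  obtain ⟨y₁, hy₁⟩ := hne
  set F := S ∩ closedBall x (dist y₁ x) with hF
  have hFfin : F.Finite := finite_sep_inter_closedBall hδ hS x _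
  have hy₁F : y₁ ∈ F := ⟨hy₁, mem_closedBall.2 le_rfl⟩
  obtain ⟨y, hyF, hmin⟩ := Set.exists_min_image F (fun y => dist y x) hFfin ⟨y₁, hy₁F⟩
  refine ⟨y, hyF.1, ?_⟩
  by_contra hfar
  rw [not_lt] at hfar
  obtain ⟨z, hz, -, -, hzd⟩ := clean_hop_sq (hgood y hyF.1) hfar
  have hlt : dist z x < dist y x :=
    lt_of_pow_lt_pow_left₀ 2 dist_nonneg (by linarith [hzd])
  have hzF : z ∈ F := ⟨hz, mem_closedBall.2 (hlt.le.trans (hmin y₁ hy₁F))⟩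
  exact absurd (hmin z hzF) (not_le.2 hlt)

/-- (COV, atoms) HOP-TO-ATOM UNIQUENESS (PROVED): in a `27/32`-separated set an atom within `4/5` of an atom IS that atom (`4/5 < 27/32`, MARGIN `7/160`);
so hopping toward an ATOM `x ∈ S` terminates AT `x`. [g91] -/
theorem eq_of_dist_lt_four_fifths (hS : IsSep (27 / 32) S) {y x : E3} (hy : y ∈ S) (hx : x ∈ S) (hd : dist y x < 4 / 5) : y = x := by
  by_contra hne
  have h := hS y hy x hx hne
  linarith

/-- (COV, REG-in arithmetic) `4/5 + 10⁻⁴ < 27/32` (PROVED, `norm_num`): an atom within `4/5` of a placed site and a placed site within `10⁻⁴` of an atom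
are forced together by the hard core `27/32` of the PLACED crystal (MARGIN `7/160 − 10⁻⁴`). [g91] -/
theorem four_fifths_add_eps_lt_hardCore : (4 : ℝ) / 5 + 1 / 10000 < 27 / 32 := by norm_num

end Cover

end Summit.AtomisticToContinuum.Crystallization.Theorems.ChartedZeroExcessLayeredLatticeLiouville

end
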